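import Summits.QuantumFields.BalabanUV.Beta.AxialDressingRootedLinear

/-!
# The ROOTED axial dressing `Πᵀ_ρ` — part 7: letter sites of the axial contour and the SUPPORT of the projector matrix

HONEST FRAMING (cell charter, verbatim): «discharging BetaPertH makes Balaban's UV stability UNCONDITIONAL — a real
constructive-QFT result; it is NOT the continuum limit and NOT the Clay problem.»  DERIVED cell leaf (pub-balaban β sub-cell,
lane an2 gen 12, item (ii-2a) of NOTE X-an2-41 §4, file 1 of 2); no statement of Bałaban's papers is typed here, no `[cite:]` tag,
no `Prop` fact (`InHull` is a predicate on three lattice points); it instantiates no binder of the β-function wall by itself.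
NOT `BetaPertH`; NOT continuum; NOT Clay.

## What is here

* §1 LETTER SITES of an1's axial contour `AveragingContours.axial A y x`: every letter is `±A_κ(z′)` for a bond `[z′, z′ + e_κ]` inside
  the coordinatewise hull of `y` and `x` (`mem_segUp_site`, `mem_segDown_site`, `mem_seg_site`, `mem_axialAux_hull`, `mem_axial_hull`);
  hence the SUPPORT of the rooted tree integral of a bond indicator (`treeGaugeAt_bondInd_ne_zero`: the bond lies in the block) and of
  the projector matrix of part 1 (`pm_ne_zero`: `pm (toSite r) N b p a q ≠ 0` forces `|p_i − q_i| ≤ N − 1` off the leg axis `b` and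
  `−N ≤ p_b − q_b ≤ N − 1`), and the two WINDOW LEMMAS `window_of_pm_ne_zero` (`p − q ∈ cube`: the window of part 1 carries the whole
  matrix) and `window_refl_of_pm_ne_zero` (`bref α b p − bref α a q ∈ cube`: … and its axis-reflected image).

Part 8 (`AxialDressingRootedReflection`) uses these to prove `refK (Φ N α) (piK ctr N) = piK ctr N` and the reflection invariance of
the co-dressed step resolvents.  All declarations `[folklore]` (list bookkeeping); axioms standard.
Provenance: b2b-balaban β sub-cell, unit beta-an2 gen 12, 2026-08-19 (v1); over parts 1–5 and an1's `AveragingContours(Rooted)`,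
an2's `AxialProjector` (block bounds) BY NAME; no existing file touched.
-/

open Finset
open scoped BigOperators
open Literature.MathematicalPhysics.QuantumFieldTheory
open Literature.MathematicalPhysics.QuantumFieldTheory.Balaban1983to89
open Literature.MathematicalPhysics.QuantumFieldTheory.Balaban1983to89.Beta
open B12Sec2to5 (l1 l1_nonneg)
open ExpKernelCalculus (MKer Decays BiLoc comp tr shiftK)
open AffineAveraging (Form0 Form1 box toSite unitVec unitVec_apply)
open AveragingContours (blk segUp segDown seg corner axialAux axial grad)
open AveragingContoursRooted (treeGaugeAt ctrOff ctr ctrOff_mem_box)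
open RootedComb (axProjAt axProjAt_apply axProjAt_R1 ctr_eq_toSite)
open AxialProjector (zsmul_blk_le lt_zsmul_blk_add axial_map)
open PolarizationSign (reflSign)
open KernelReflection (LegMap refK refK_apply comp_refK)
open ResolventReflection (sref sref_apply bref bref_apply bref_bref mref mref_mref R1 Φ Φ_r_inl Φ_r_inr Φ_s_inl Φ_s_inr reflSign_mul_self refK_KInvStep)
open OneStepResolventKernel (Fib)
open OneStepKernelFamily (KInvStep decays_KInvStep)
open Summit.QuantumFields.BalabanUV.Beta.TameKernelCalculus

namespace Summit.QuantumFields.BalabanUV.Beta.AxialDressingRooted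

noncomputable section

variable {n : ℕ}

/-! ## §1 Letter sites of the axial contour; support of the rooted tree integral and of the projector matrix -/

section Support

/-- [folklore] `z` lies in the coordinatewise hull of `y` and `x`. -/
def InHull (y x z : Fin n → ℤ) : Prop := ∀ j, min (y j) (x j) ≤ z j ∧ z j ≤ max (y j) (x j)

/-- [folklore] Bounds on `y_j`, `x_j` pass to a hull point. -/
theorem InHull.bounds {y x z : Fin n → ℤ} (h : InHull y x z) {j : Fin n} {L U : ℤ} (hyL : L ≤ y j) (hyU : y j ≤ U)
    (hxL : L ≤ x j) (hxU : x j ≤ U) : L ≤ z j ∧ z j ≤ U :=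
  ⟨le_trans (le_min hyL hxL) (h j).1, le_trans (h j).2 (max_le hyU hxU)⟩

variable {R : Type*} [AddCommGroup R]

omit [AddCommGroup R] in
/-- [folklore] Letters of an upward segment with their sites: `a = A κ (z + s e_κ)`, `s < m`. -/
theorem mem_segUp_site {A : Form1 n R} {z : Fin n → ℤ} {κ : Fin n} {a : R} :
    ∀ {m : ℕ}, a ∈ segUp A z κ m → ∃ s : ℕ, s < m ∧ a = A κ (z + (s : ℤ) • unitVec κ)
  | 0, h => by simp at h
  | m + 1, h => by
    rw [AveragingContours.segUp_succ, List.mem_append, List.mem_singleton] at h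
    rcases h with h | h
    · obtain ⟨s, hs, e⟩ := mem_segUp_site h
      exact ⟨s, Nat.lt_succ_of_lt hs, e⟩
    · exact ⟨m, Nat.lt_succ_self m, h⟩

/-- [folklore] Letters of a downward segment with their sites: `a = −A κ (z − (s+1) e_κ)`, `s < m`. -/
theorem mem_segDown_site {A : Form1 n R} {z : Fin n → ℤ} {κ : Fin n} {a : R} :
    ∀ {m : ℕ}, a ∈ segDown A z κ m → ∃ s : ℕ, s < m ∧ a = -A κ (z - ((s : ℤ) + 1) • unitVec κ)
  | 0, h => by simp at h
  | m + 1, h => by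
    rw [AveragingContours.segDown_succ, List.mem_append, List.mem_singleton] at h
    rcases h with h | h
    · obtain ⟨s, hs, e⟩ := mem_segDown_site h
      exact ⟨s, Nat.lt_succ_of_lt hs, e⟩
    · exact ⟨m, Nat.lt_succ_self m, h⟩

/-- [folklore] **LETTER SITES OF A STRAIGHT SEGMENT**: a letter of `seg A z κ m` is `±A_κ(z′)` for a bond `[z′, z′ + e_κ]` on the
segment from `z` to `z + m e_κ`: `z′_j = z_j` off the axis, and `min(z_κ, z_κ + m) ≤ z′_κ`, `z′_κ + 1 ≤ max(z_κ, z_κ + m)`. -/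
theorem mem_seg_site {A : Form1 n R} {z : Fin n → ℤ} {κ : Fin n} {m : ℤ} {a : R} (h : a ∈ seg A z κ m) :
    ∃ z' : Fin n → ℤ, (a = A κ z' ∨ a = -A κ z') ∧ (∀ j, j ≠ κ → z' j = z j) ∧
      min (z κ) (z κ + m) ≤ z' κ ∧ z' κ + 1 ≤ max (z κ) (z κ + m) := by
  unfold AveragingContours.seg at h
  split_ifs at h with hm
  · obtain ⟨s, hs, e⟩ := mem_segUp_site h
    have hs' : (s : ℤ) < m.toNat := by exact_mod_cast hs
    rw [Int.toNat_of_nonneg hm] at hs'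
    have hmin : min (z κ) (z κ + m) = z κ := min_eq_left (by omega)
    have hmax : max (z κ) (z κ + m) = z κ + m := max_eq_right (by omega)
    refine ⟨z + (s : ℤ) • unitVec κ, Or.inl e, fun j hj => by simp [hj], ?_, ?_⟩
    · rw [hmin]
      simp only [Pi.add_apply, Pi.smul_apply, unitVec_apply, if_true, smul_eq_mul, mul_one]
      have : (0 : ℤ) ≤ s := by positivity
      omega
    · rw [hmax]
      simp only [Pi.add_apply, Pi.smul_apply, unitVec_apply, if_true, smul_eq_mul, mul_one]
      omega
  · have hm' : m < 0 := not_le.1 hm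
    obtain ⟨s, hs, e⟩ := mem_segDown_site h
    have hs' : (s : ℤ) < (-m).toNat := by exact_mod_cast hs
    rw [Int.toNat_of_nonneg (by omega)] at hs'
    have hmin : min (z κ) (z κ + m) = z κ + m := min_eq_right (by omega)
    have hmax : max (z κ) (z κ + m) = z κ := max_eq_left (by omega)
    refine ⟨z - ((s : ℤ) + 1) • unitVec κ, Or.inr e, fun j hj => by simp [hj], ?_, ?_⟩
    · rw [hmin]
      simp only [Pi.sub_apply, Pi.smul_apply, unitVec_apply, if_true, smul_eq_mul, mul_one]
      omega
    · rw [hmax]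
      simp only [Pi.sub_apply, Pi.smul_apply, unitVec_apply, if_true, smul_eq_mul, mul_one]
      have : (0 : ℤ) ≤ s := by positivity
      omega

/-- [folklore] Coordinates of the corner points lie in the hull (they are `x_j` or `y_j`). -/
theorem corner_mem_hull (y x : Fin n → ℤ) (m : ℕ) : InHull y x (corner y x m) := by
  intro j
  simp only [corner]
  split_ifs
  · exact ⟨min_le_right _ _, le_max_right _ _⟩
  · exact ⟨min_le_left _ _, le_max_left _ _⟩

/-- [folklore] **LETTER SITES OF THE PARTIAL AXIAL CONTOURS**: every letter is `±A_κ(z′)` with `z′` AND `z′ + e_κ` in the hull of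
`y` and `x`. -/
theorem mem_axialAux_hull {A : Form1 n R} {y x : Fin n → ℤ} {a : R} :
    ∀ {m : ℕ}, a ∈ axialAux A y x m →
      ∃ (κ : Fin n) (z' : Fin n → ℤ), (a = A κ z' ∨ a = -A κ z') ∧ InHull y x z' ∧ InHull y x (z' + unitVec κ)
  | 0, h => by simp [axialAux] at h
  | m + 1, h => by
    simp only [axialAux, List.mem_append] at h
    rcases h with h | h
    · split_ifs at h with hm
      · obtain ⟨z', e, hoff, hlo, hhi⟩ := mem_seg_site h
        have hc := corner_mem_hull y x (m + 1)
        have hκ : (corner y x (m + 1)) ⟨m, hm⟩ = y ⟨m, hm⟩ := by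
          simp [corner]
        refine ⟨⟨m, hm⟩, z', e, fun j => ?_, fun j => ?_⟩
        · by_cases hj : j = ⟨m, hm⟩
          · subst hj
            rw [hκ, add_sub_cancel] at hlo hhi
            constructor
            · exact hlo
            · have := le_max_left (y ⟨m, hm⟩) (x ⟨m, hm⟩)
              have := le_max_right (y ⟨m, hm⟩) (x ⟨m, hm⟩)
              rcases le_total (y ⟨m, hm⟩) (x ⟨m, hm⟩) with hxy | hxy
              · rw [max_eq_right hxy] at hhi ⊢; omega
              · rw [max_eq_left hxy] at hhi ⊢; omega
          · rw [hoff j hj]; exact hc j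
        · by_cases hj : j = ⟨m, hm⟩
          · subst hj
            rw [hκ, add_sub_cancel] at hlo hhi
            simp only [Pi.add_apply, unitVec_apply, if_true]
            constructor
            · rcases le_total (y ⟨m, hm⟩) (x ⟨m, hm⟩) with hxy | hxy
              · rw [min_eq_left hxy] at hlo ⊢; omega
              · rw [min_eq_right hxy] at hlo ⊢; omega
            · exact hhi
          · simp only [Pi.add_apply, unitVec_apply, if_neg hj, add_zero]
            rw [hoff j hj]; exact hc j
      · simp at h
    · exact mem_axialAux_hull h

/-- [folklore] **LETTER SITES OF THE AXIAL CONTOUR** `Γ_{y,x}`: `±A_κ(z′)` with the bond `[z′, z′ + e_κ]` inside the hull of `y`, `x`. -/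
theorem mem_axial_hull {A : Form1 n R} {y x : Fin n → ℤ} {a : R} (h : a ∈ axial A y x) :
    ∃ (κ : Fin n) (z' : Fin n → ℤ), (a = A κ z' ∨ a = -A κ z') ∧ InHull y x z' ∧ InHull y x (z' + unitVec κ) :=
  mem_axialAux_hull h

omit [AddCommGroup R] in
/-- [folklore] A list with vanishing letters has vanishing sum (contrapositive form). -/
theorem exists_mem_ne_zero_of_sum_ne_zero {M : Type*} [AddCommMonoid M] {l : List M} (h : l.sum ≠ 0) : ∃ a ∈ l, a ≠ 0 := by
  by_contra hc
  exact h (List.sum_eq_zero fun a ha => by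
    by_contra h'
    exact hc ⟨a, ha, h'⟩)

/-- [folklore] **SUPPORT OF THE ROOTED TREE INTEGRAL OF A BOND INDICATOR** (in-block root): if
`treeGaugeAt (toSite r) (bondInd a q) N p ≠ 0` then the bond `(a, q)` lies in the block of `p`: `|q_j − p_j| ≤ N − 1` and
`|q_j + [j = a] − p_j| ≤ N − 1` for every `j`. -/
theorem treeGaugeAt_bondInd_ne_zero {N : ℕ} (hN : 1 ≤ N) {r : Fin n → ℕ} (hr : r ∈ box n N) {a : Fin n}
    {q p : Fin n → ℤ} (h : treeGaugeAt (toSite r) (bondInd a q) N p ≠ 0) (j : Fin n) :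
    |q j - p j| ≤ (N : ℤ) - 1 ∧ |q j + (if j = a then 1 else 0) - p j| ≤ (N : ℤ) - 1 := by
  unfold treeGaugeAt at h
  obtain ⟨c, hc, hc0⟩ := exists_mem_ne_zero_of_sum_ne_zero h
  obtain ⟨κ, z', e, hz, hz'⟩ := mem_axial_hull hc
  -- the letter is `± bondInd a q κ z' ≠ 0`, so `(κ, z') = (a, q)`
  have hκq : κ = a ∧ z' = q := by
    by_contra hne
    have h0 : bondInd a q κ z' = 0 := by
      rw [bondInd_apply, if_neg]
      exact fun h' => hne ⟨h'.1, h'.2⟩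
    rcases e with e | e
    · exact hc0 (by rw [e, h0])
    · exact hc0 (by rw [e, h0, neg_zero])
  obtain ⟨hκa, hzq⟩ := hκq
  rw [hzq] at hz hz'
  rw [hκa] at hz'
  have hrj : ((r j : ℕ) : ℤ) < N := by exact_mod_cast Finset.mem_range.1 (Fintype.mem_piFinset.1 hr j)
  have hr0 : (0 : ℤ) ≤ (r j : ℕ) := by positivity
  have a1 := zsmul_blk_le hN p j
  have a2 := lt_zsmul_blk_add hN p j
  have eroot : ((N : ℤ) • blk N p + toSite r) j = ((N : ℤ) • blk N p) j + ((r j : ℕ) : ℤ) := by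
    simp only [Pi.add_apply, toSite]
  have b1 := InHull.bounds hz (j := j) (L := ((N : ℤ) • blk N p) j) (U := ((N : ℤ) • blk N p) j + N - 1)
    (by rw [eroot]; omega) (by rw [eroot]; omega) a1 (by omega)
  have b2 := InHull.bounds hz' (j := j) (L := ((N : ℤ) • blk N p) j) (U := ((N : ℤ) • blk N p) j + N - 1)
    (by rw [eroot]; omega) (by rw [eroot]; omega) a1 (by omega)
  simp only [Pi.add_apply, unitVec_apply] at b2
  constructor
  · rw [abs_le]; constructor <;> omega
  · rw [abs_le]
    by_cases hja : j = a
    · rw [if_pos hja] at b2 ⊢; constructor <;> omega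
    · rw [if_neg hja] at b2 ⊢; constructor <;> omega

/-- [folklore] **SUPPORT OF THE PROJECTOR MATRIX** (in-block root): `pm (toSite r) N b p a q ≠ 0` forces the stencil bond `(a, q)` into
the block of `p` or of `p + e_b` (or `(b, p) = (a, q)`), hence `|p_i − q_i| ≤ N − 1` for `i ≠ b` and `−N ≤ p_b − q_b ≤ N − 1`. -/
theorem pm_ne_zero {N : ℕ} (hN : 1 ≤ N) {r : Fin n → ℕ} (hr : r ∈ box n N) {b : Fin n} {p : Fin n → ℤ} {a : Fin n}
    {q : Fin n → ℤ} (h : pm (toSite r) N b p a q ≠ 0) (i : Fin n) :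
    (i ≠ b → |p i - q i| ≤ (N : ℤ) - 1) ∧ (-(N : ℤ) ≤ p i - q i ∧ p i - q i ≤ (N : ℤ) - 1) := by
  rw [pm_eq, axProjAt_apply] at h
  -- three cases: the indicator, the tree integral at `p + e_b`, the tree integral at `p`
  by_cases h1 : treeGaugeAt (toSite r) (bondInd a q) N (p + unitVec b) ≠ 0
  · have k := (treeGaugeAt_bondInd_ne_zero hN hr h1 i).1
    simp only [Pi.add_apply, unitVec_apply] at k
    rw [abs_le] at k
    refine ⟨fun hib => ?_, ?_, ?_⟩
    · rw [if_neg hib] at k; rw [abs_le]; constructor <;> omega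
    · by_cases hib : i = b
      · rw [if_pos hib] at k; omega
      · rw [if_neg hib] at k; omega
    · by_cases hib : i = b
      · rw [if_pos hib] at k; omega
      · rw [if_neg hib] at k; omega
  · have h1' : treeGaugeAt (toSite r) (bondInd a q) N (p + unitVec b) = 0 := not_ne_iff.1 h1
    by_cases h2 : treeGaugeAt (toSite r) (bondInd a q) N p ≠ 0
    · have k := (treeGaugeAt_bondInd_ne_zero hN hr h2 i).1
      rw [abs_le] at k
      have hN1 : (1 : ℤ) ≤ N := by exact_mod_cast hN
      refine ⟨fun _ => ?_, ?_, ?_⟩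
      · rw [abs_le]; constructor <;> omega
      · omega
      · omega
    · have h2' : treeGaugeAt (toSite r) (bondInd a q) N p = 0 := not_ne_iff.1 h2
      rw [h1', h2', sub_zero, sub_zero, bondInd_apply] at h
      split_ifs at h with hbp
      · obtain ⟨rfl, rfl⟩ := hbp
        have hN1 : (1 : ℤ) ≤ N := by exact_mod_cast hN
        refine ⟨fun _ => ?_, ?_, ?_⟩
        · rw [sub_self, abs_zero]; omega
        · rw [sub_self]; omega
        · rw [sub_self]; omega
      · exact absurd rfl h

/-- [folklore] The window of part 1 carries the whole matrix: `pm ≠ 0 ⇒ p − q ∈ cube`. -/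
theorem window_of_pm_ne_zero {N : ℕ} (hN : 1 ≤ N) {r : Fin n → ℕ} (hr : r ∈ box n N) {b : Fin n} {p : Fin n → ℤ}
    {a : Fin n} {q : Fin n → ℤ} (h : pm (toSite r) N b p a q ≠ 0) : p - q ∈ cube n N := by
  rw [mem_cube]
  intro i
  have k := (pm_ne_zero hN hr h i).2
  rw [Pi.sub_apply, abs_le]
  constructor <;> omega

/-- [folklore] … and its axis-reflected image: `pm ≠ 0 ⇒ bref α b p − bref α a q ∈ cube`. -/
theorem window_refl_of_pm_ne_zero {N : ℕ} (hN : 1 ≤ N) {r : Fin n → ℕ} (hr : r ∈ box n N) {b : Fin n} {p : Fin n → ℤ}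
    {a : Fin n} {q : Fin n → ℤ} (h : pm (toSite r) N b p a q ≠ 0) (α : Fin n) : bref α b p - bref α a q ∈ cube n N := by
  rw [mem_cube]
  intro i
  have k := pm_ne_zero hN hr h i
  rw [Pi.sub_apply, bref_apply, bref_apply, abs_le]
  by_cases hiα : i = α
  · rw [if_pos hiα, if_pos hiα]
    by_cases hb : b = α <;> by_cases ha : a = α
    · rw [if_pos hb, if_pos ha]; have := k.2; constructor <;> omega
    · rw [if_pos hb, if_neg ha]; have := k.2; constructor <;> omega
    · rw [if_neg hb, if_pos ha]
      have hib : i ≠ b := fun e => hb (e ▸ hiα)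
      have := abs_le.1 (k.1 hib); constructor <;> omega
    · rw [if_neg hb, if_neg ha]
      have := k.2; constructor <;> omega
  · rw [if_neg hiα, if_neg hiα]
    have := k.2; constructor <;> omega

end Support

end

end Summit.QuantumFields.BalabanUV.Beta.AxialDressingRooted
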